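import Mathlib
import Literature.Analysis.ODE.MaximalTime
import Literature.Analysis.ODE.OneSidedComparison
import Literature.Analysis.ODE.LinearComparison
import Literature.Barriers.NavierStokesRegularity.DyadicCascadePositivity
import HarnessLib

/-!
# The viscous dyadic model: parabolic smoothing from the scale `λₙ^{β-2+ε}`
  (Barbato–Morandin–Romito 2011, §3.2, proof of Theorem 1, "second claim")

Barrier catalogue `Literature/Barriers/NavierStokesRegularity/`, seventh **proof file** towards
the named fact `Dyadic.BarbatoMorandinRomito2011_thm1` (`DyadicCascadeRegularity`). Two
ingredients of the proof of Theorem 1 that concern a single weak solution: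

* `IsBMRWeakSolution.exists_summable_dissipation` — "by the energy inequality
  `∑ₙ∫₀ᵗ(λₙXₙ)² < ∞`, hence `sup_n(λₙXₙ(t)) < ∞` for a.e. `t > 0`. Let `t₀ > 0` be one of these
  times": in every interval `(a, b)`, `0 ≤ a < b`, there is `t₀` with `∑ₙ λₙ²Xₙ(t₀)² < ∞`
  (Tonelli for the non-negative series, `ae_lt_top`, and positivity of Lebesgue measure of
  `(a, b)`);
* `IsBMRWeakSolution.scale_exp_bound` — the **second claim** in quantitative form (with
  `ε = 1/100`): if `λₙ^{β-2+ε}xₙ ≤ K` for all `n ≥ 1`, then for `0 ≤ t ≤ T` with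
  `4K·C₀·T^{ε/2} ≤ 1/2`, `C₀ = 2^{β-2+ε}(2ν)^{-(1-ε/2)}`, one has
  `λₙ^{β-2+ε} e^{νλₙt} Xₙ(t) ≤ 2K` for all `n ≥ 1`. BMR set `Vₙ = Xₙe^{νλₙ(t-t₀)}`, note
  `V̇ₙ ≤ -ν/2·λₙ²Vₙ + λ_{n-1}^βV_{n-1}²` (this uses `λₙ = 2λ_{n-1}` exactly and positivity) and invoke a
  Banach fixed point in `W_ε` on a short interval (Remark 3.4, gain `T^{ε/2}`); here the same
  estimate is closed by a continuity (bootstrap) argument on `max_{n≤N} sup_{[0,t]} λₙ^{β-2+ε}Vₙ`,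
  uniformly in `N`: by linear comparison (`le_linearComparison`)
  `Vₙ(t) ≤ Vₙ(0) + sup A · min{t, aₙ⁻¹}`, `aₙ = ν(λₙ²-λₙ) ≥ νλₙ²/2`, and the interpolation
  `min{t, (2νL²)⁻¹} ≤ t^{ε/2}(2νL²)^{-(1-ε/2)}` makes the gain `λₙ^{β-2+ε}λ_{n-1}^{β-2(β-2+ε)}λₙ^{-(2-ε)}`
  exactly scale-free (`mode_step`);
* `weighted_bound_of_exp_bound` — the conclusion "then `X` is smooth": a bound
  `λₙ^{β-2+ε}e^{νλₙt}Xₙ(t) ≤ M` with `t > 0` gives `sup_n λₙ^γXₙ(t) < ∞` for every `γ > 0`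
  (`e^{νtλ} ≥ (νtλ)^k/k!`).

Theorem-only module.

## References

* D. Barbato, F. Morandin, M. Romito, *Smooth solutions for the dyadic model*, Nonlinearity 24
  (2011) 3083–3097, §3.2 (proof of Thm. 1: choice of `t₀`, second claim), Remark 3.4. [`BarbatoMorandinRomito2011`]
-/

noncomputable section

open Set Filter MeasureTheory intervalIntegral
open scoped Topology BigOperators ENNReal NNReal

namespace Literature.Barriers.NavierStokesRegularity.Dyadic

/-! ## Good times: finiteness of `∑ λₙ²Xₙ(t₀)²` almost everywhere -/

section GoodTimes

variable {ν β : ℝ} {x : ℕ → ℝ} {X : ℕ → ℝ → ℝ}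

/-- **Choice of `t₀`** ("by the energy inequality, `∑ₙ∫₀ᵗ(λₙXₙ(s))²ds < ∞`, hence
`sup_n(λₙXₙ(t)) < ∞` for a.e. `t > 0`"): for `ν > 0`, `β ≠ 0` and a weak solution with
non-negative square-summable datum, every interval `(a, b)` with `0 ≤ a < b` contains a time `t₀`
at which `∑ₙ λ_{n}²X_{n}(t₀)²` converges (sum over `n ≥ 1`, written with `n = m + 1`).
[cite: BarbatoMorandinRomito2011, §3.2 (proof of Thm. 1)] -/
theorem IsBMRWeakSolution.exists_summable_dissipation (hX : IsBMRWeakSolution ν β x X) (hβ : β ≠ 0)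
    (hν : 0 < ν) (hx : ∀ n, 1 ≤ n → 0 ≤ x n) (hx2 : Summable fun n => x n ^ 2) {a b : ℝ}
    (ha : 0 ≤ a) (hab : a < b) :
    ∃ t₀ ∈ Ioo a b, Summable fun m => bmrLambda (m + 1) ^ 2 * X (m + 1) t₀ ^ 2 := by
  have hb : 0 ≤ b := ha.trans hab.le
  -- the clamped, continuous, non-negative summands
  set f : ℕ → ℝ → ℝ := fun m τ => bmrLambda (m + 1) ^ 2 * X (m + 1) (max τ 0) ^ 2 with hf
  have hfc : ∀ m, Continuous (f m) := fun m =>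
    continuous_const.mul ((hX.continuous_clamp (by omega)).pow 2)
  have hf0 : ∀ m τ, 0 ≤ f m τ := fun m τ => mul_nonneg (sq_nonneg _) (sq_nonneg _)
  -- summability of the integrals (energy inequality)
  have hsum : Summable fun m => ∫ τ in (0 : ℝ)..b, f m τ := by
    have h := hX.summable_integral_dissipation hβ hν hx hx2 hb
    refine h.congr fun m => intervalIntegral.integral_congr fun τ hτ => ?_
    rw [uIcc_of_le hb] at hτ
    simp only [hf, max_eq_left hτ.1]
  -- Tonelli
  set F : ℝ → ℝ≥0∞ := fun τ => ∑' m, ENNReal.ofReal (f m τ) with hF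
  have hFm : Measurable F := by
    have : F = fun τ => ⨆ N, ∑ m ∈ Finset.range N, ENNReal.ofReal (f m τ) := by
      funext τ; simp only [hF, ENNReal.tsum_eq_iSup_nat]
    rw [this]
    exact Measurable.iSup fun N => Finset.measurable_sum _ fun m _ =>
      (hfc m).measurable.ennreal_ofReal
  have hlint : ∫⁻ τ in Ioc 0 b, F τ = ∑' m, ENNReal.ofReal (∫ τ in (0 : ℝ)..b, f m τ) := by
    rw [lintegral_tsum fun m => ((hfc m).measurable.ennreal_ofReal).aemeasurable]
    refine tsum_congr fun m => ?_
    rw [intervalIntegral.integral_of_le hb, ← ofReal_integral_eq_lintegral_ofReal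
      (((hfc m).continuousOn).integrableOn_Icc.mono_set Ioc_subset_Icc_self)
      (ae_of_all _ fun τ => hf0 m τ)]
  have hfin : ∫⁻ τ in Ioc 0 b, F τ ≠ ∞ := by
    rw [hlint, ← ENNReal.ofReal_tsum_of_nonneg (fun m => intervalIntegral.integral_nonneg hb
      fun τ _ => hf0 m τ) hsum]
    exact ENNReal.ofReal_ne_top
  have hae : ∀ᵐ τ ∂(volume.restrict (Ioc 0 b)), F τ < ∞ := ae_lt_top hFm hfin
  have hae' : ∀ᵐ τ ∂(volume.restrict (Ioo a b)), F τ < ∞ :=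
    ae_restrict_of_ae_restrict_of_subset
      (show Ioo a b ⊆ Ioc 0 b from fun τ hτ => ⟨ha.trans_lt hτ.1, hτ.2.le⟩) hae
  have hmem : ∀ᵐ τ ∂(volume.restrict (Ioo a b)), τ ∈ Ioo a b := ae_restrict_mem measurableSet_Ioo
  have hne : volume.restrict (Ioo a b) ≠ 0 := by
    rw [Ne, Measure.restrict_eq_zero, Real.volume_Ioo, ENNReal.ofReal_eq_zero, not_le]
    linarith
  haveI : (ae (volume.restrict (Ioo a b))).NeBot := ae_neBot.2 hne
  obtain ⟨t₀, ht₀F, ht₀mem⟩ := (hae'.and hmem).exists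
  refine ⟨t₀, ht₀mem, ?_⟩
  -- finiteness of `F t₀` is summability
  have ht₀0 : 0 ≤ t₀ := ha.trans ht₀mem.1.le
  have hne_top : ∑' m, ((f m t₀).toNNReal : ℝ≥0∞) ≠ ∞ := by
    have : ∑' m, ((f m t₀).toNNReal : ℝ≥0∞) = F t₀ := by
      simp only [hF]
      rfl
    rw [this]
    exact ht₀F.ne
  have hsNN : Summable fun m => (f m t₀).toNNReal := ENNReal.tsum_coe_ne_top_iff_summable.1 hne_top
  have hsR : Summable fun m => ((f m t₀).toNNReal : ℝ) := NNReal.summable_coe.2 hsNN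
  refine hsR.congr fun m => ?_
  rw [Real.coe_toNNReal _ (hf0 m t₀)]
  simp only [hf, max_eq_left ht₀0]

/-- At a good time the weighted amplitudes `λₙ^{s}Xₙ(t₀)`, `s ≤ 1`, are bounded: if
`∑ λₙ²Xₙ(t₀)² ≤ S` then `λₙ^sXₙ(t₀) ≤ √S` for `n ≥ 1` (`Xₙ ≥ 0`, `λₙ ≥ 1`).
[cite: BarbatoMorandinRomito2011, §3.2 (proof of Thm. 1)] -/
theorem rpow_mul_le_sqrt_of_summable {Z : ℕ → ℝ} (hZ : ∀ n, 1 ≤ n → 0 ≤ Z n)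
    (hs : Summable fun m => bmrLambda (m + 1) ^ 2 * Z (m + 1) ^ 2) {s : ℝ} (hs1 : s ≤ 1) {n : ℕ}
    (hn : 1 ≤ n) :
    bmrLambda n ^ s * Z n ≤ Real.sqrt (∑' m, bmrLambda (m + 1) ^ 2 * Z (m + 1) ^ 2) := by
  obtain ⟨m, rfl⟩ : ∃ m, n = m + 1 := ⟨n - 1, by omega⟩
  have hL1 : 1 ≤ bmrLambda (m + 1) := one_le_bmrLambda (by omega)
  have hZ0 := hZ (m + 1) hn
  have h1 : bmrLambda (m + 1) ^ s ≤ bmrLambda (m + 1) := by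
    calc bmrLambda (m + 1) ^ s ≤ bmrLambda (m + 1) ^ (1 : ℝ) :=
          Real.rpow_le_rpow_of_exponent_le hL1 hs1
      _ = bmrLambda (m + 1) := Real.rpow_one _
  have h2 : bmrLambda (m + 1) * Z (m + 1) ≤
      Real.sqrt (∑' m, bmrLambda (m + 1) ^ 2 * Z (m + 1) ^ 2) := by
    refine Real.le_sqrt_of_sq_le ?_
    rw [mul_pow]
    exact hs.le_tsum m fun j _ => mul_nonneg (sq_nonneg _) (sq_nonneg _)
  exact (mul_le_mul_of_nonneg_right h1 hZ0).trans h2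

end GoodTimes

/-! ## Elementary inequalities -/

/-- Interpolation: `min{a, b} ≤ a^θ b^{1-θ}` for `a, b ≥ 0`, `θ ∈ [0, 1]`. [folklore] -/
theorem min_le_rpow_mul_rpow {a b θ : ℝ} (ha : 0 ≤ a) (hb : 0 ≤ b) (hθ0 : 0 ≤ θ) (hθ1 : θ ≤ 1) :
    min a b ≤ a ^ θ * b ^ (1 - θ) := by
  have hm0 : 0 ≤ min a b := le_min ha hb
  rcases eq_or_lt_of_le hm0 with h0 | hpos
  · rw [← h0]; positivity
  · calc min a b = (min a b) ^ θ * (min a b) ^ (1 - θ) := by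
          rw [← Real.rpow_add hpos, add_sub_cancel, Real.rpow_one]
      _ ≤ a ^ θ * b ^ (1 - θ) :=
          mul_le_mul (Real.rpow_le_rpow hm0 (min_le_left a b) hθ0)
            (Real.rpow_le_rpow hm0 (min_le_right a b) (by linarith))
            (Real.rpow_nonneg hm0 _) (Real.rpow_nonneg ha _)

/-- `∫₀ᵗ e^{ar} dr = (e^{at} - 1)/a` for `a ≠ 0`. [folklore] -/
theorem integral_exp_const_mul {a : ℝ} (ha : a ≠ 0) (t : ℝ) :
    ∫ r in (0 : ℝ)..t, Real.exp (a * r) = (Real.exp (a * t) - 1) / a := by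
  have h : ∀ r ∈ uIcc 0 t, HasDerivAt (fun r => Real.exp (a * r) / a) (Real.exp (a * r)) r := by
    intro r _
    have h1 := ((hasDerivAt_id r).const_mul a).exp.div_const a
    simp only [id, mul_one] at h1
    rwa [mul_div_cancel_right₀ _ ha] at h1
  rw [intervalIntegral.integral_eq_sub_of_hasDerivAt h
    ((Real.continuous_exp.comp (continuous_const.mul continuous_id)).intervalIntegrable _ _)]
  simp only [mul_zero, Real.exp_zero]
  ring

/-- `(1 - e^{-at})/a ≤ min{t, a⁻¹}` for `a > 0`, `t ≥ 0`. [folklore] -/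
theorem one_sub_exp_neg_div_le {a t : ℝ} (ha : 0 < a) :
    (1 - Real.exp (-(a * t))) / a ≤ min t (1 / a) := by
  refine le_min ?_ ?_
  · rw [div_le_iff₀ ha]
    have := Real.add_one_le_exp (-(a * t))
    linarith
  · exact div_le_div_of_nonneg_right (by linarith [Real.exp_pos (-(a * t))]) ha.le

/-- The smoothing weight beats every power: for `c > 0`, `L ≥ 1`, `γ ≤ k` (`k ∈ ℕ`),
`L^γ e^{-cL} ≤ k!/c^k`. [folklore] -/
theorem rpow_mul_exp_neg_le_factorial_div {c L γ : ℝ} {k : ℕ} (hc : 0 < c) (hL : 1 ≤ L)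
    (hγk : γ ≤ k) : L ^ γ * Real.exp (-(c * L)) ≤ (k.factorial : ℝ) / c ^ k := by
  have hL0 : 0 < L := by linarith
  have h1 : L ^ γ ≤ L ^ (k : ℝ) := Real.rpow_le_rpow_of_exponent_le hL hγk
  rw [Real.rpow_natCast] at h1
  have h2 : (c * L) ^ k / k.factorial ≤ Real.exp (c * L) :=
    Real.pow_div_factorial_le_exp (c * L) (by positivity) k
  have hk : (0 : ℝ) < k.factorial := by exact_mod_cast Nat.factorial_pos k
  have h3 : L ^ k * Real.exp (-(c * L)) ≤ (k.factorial : ℝ) / c ^ k := by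
    rw [Real.exp_neg, ← div_eq_mul_inv, div_le_div_iff₀ (Real.exp_pos _) (pow_pos hc k)]
    rw [div_le_iff₀ hk, mul_pow] at h2
    nlinarith
  calc L ^ γ * Real.exp (-(c * L)) ≤ L ^ k * Real.exp (-(c * L)) :=
        mul_le_mul_of_nonneg_right h1 (Real.exp_pos _).le
    _ ≤ _ := h3

/-! ## From the exponential bound to smoothness -/

/-- **"…then `X` is smooth"**: a bound `λₙ^{s}e^{νλₙt}Zₙ ≤ M` (`s ≥ 0`, `ν, t > 0`, `Zₙ ≥ 0`) at all
modes `n ≥ 1` yields, for every `γ` (the source: `γ > 0`), `sup_{n≥1} λₙ^γZₙ < ∞` — explicitly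
`≤ M·k!/(νt)^k` with `k = ⌈γ⌉₊`. [cite: BarbatoMorandinRomito2011, §3.2 (proof of Thm. 1, second claim)] -/
theorem weighted_bound_of_exp_bound {ν t s M : ℝ} {Z : ℕ → ℝ} (hν : 0 < ν) (ht : 0 < t) (hs : 0 ≤ s)
    (hZ : ∀ n, 1 ≤ n → 0 ≤ Z n)
    (hbd : ∀ n, 1 ≤ n → bmrLambda n ^ s * Real.exp (ν * bmrLambda n * t) * Z n ≤ M) (γ : ℝ) :
    ∃ C : ℝ, ∀ n, 1 ≤ n → bmrLambda n ^ γ * Z n ≤ C := by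
  set k : ℕ := ⌈γ⌉₊ with hk
  refine ⟨M * ((k.factorial : ℝ) / (ν * t) ^ k), fun n hn => ?_⟩
  have hL1 : 1 ≤ bmrLambda n := one_le_bmrLambda (by omega)
  have hL0 : 0 < bmrLambda n := by linarith
  have hZn := hZ n hn
  have hM : 0 ≤ M := le_trans (by have := hbd n hn; positivity) (hbd n hn)
  -- `Zₙ ≤ M λₙ^{-s} e^{-νλₙt} ≤ M e^{-νλₙt}`
  have hexp : 0 < Real.exp (ν * bmrLambda n * t) := Real.exp_pos _
  have hLs : 1 ≤ bmrLambda n ^ s := Real.one_le_rpow hL1 hs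
  have hZle : Z n ≤ M * Real.exp (-(ν * t * bmrLambda n)) := by
    have h := hbd n hn
    have h' : Real.exp (ν * bmrLambda n * t) * Z n ≤ M := by
      calc Real.exp (ν * bmrLambda n * t) * Z n ≤ bmrLambda n ^ s * Real.exp (ν * bmrLambda n * t) * Z n := by
            rw [mul_assoc (bmrLambda n ^ s)]
            exact le_mul_of_one_le_left (mul_nonneg hexp.le hZn) hLs
        _ ≤ M := h
    rw [show ν * t * bmrLambda n = ν * bmrLambda n * t by ring, Real.exp_neg]
    rw [← div_eq_mul_inv, le_div_iff₀ hexp]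
    linarith
  have hpow := rpow_mul_exp_neg_le_factorial_div (k := k) (mul_pos hν ht) hL1 (Nat.le_ceil γ)
  calc bmrLambda n ^ γ * Z n ≤ bmrLambda n ^ γ * (M * Real.exp (-(ν * t * bmrLambda n))) :=
        mul_le_mul_of_nonneg_left hZle (Real.rpow_nonneg hL0.le _)
    _ = M * (bmrLambda n ^ γ * Real.exp (-(ν * t * bmrLambda n))) := by ring
    _ ≤ M * ((k.factorial : ℝ) / (ν * t) ^ k) := mul_le_mul_of_nonneg_left hpow hM

/-! ## The exponential-weight estimate, mode by mode -/

section Modes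

variable {ν β : ℝ} {x : ℕ → ℝ} {X : ℕ → ℝ → ℝ}

/-- The weighted mode `Vₙ = e^{νλₙt}Xₙ` of a non-negative weak solution has right derivative
`≤ -ν(λₙ² - λₙ)Vₙ + λ_{n-1}^β e^{νλₙt}X_{n-1}²` (drop the transport term `-λₙ^βXₙX_{n+1} ≤ 0`):
the differential inequality `V̇ₙ ≤ -ν(λₙ²-λₙ)Vₙ + λ_{n-1}^βV_{n-1}²` of the proof of the second
claim, before using `λₙ = 2λ_{n-1}`. [cite: BarbatoMorandinRomito2011, §3.2 (proof of Thm. 1, second claim)] -/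
theorem IsBMRWeakSolution.hasDerivWithinAt_expWeight (hX : IsBMRWeakSolution ν β x X) (m : ℕ)
    {r : ℝ} (hr : 0 ≤ r) :
    HasDerivWithinAt (fun τ => Real.exp (ν * bmrLambda (m + 1) * τ) * X (m + 1) τ)
      (Real.exp (ν * bmrLambda (m + 1) * r) * (ν * bmrLambda (m + 1)) * X (m + 1) r +
        Real.exp (ν * bmrLambda (m + 1) * r) * bmrRHS ν β (fun k => X k r) (m + 1)) (Ici r) r := by
  have h1 : HasDerivAt (fun τ => Real.exp (ν * bmrLambda (m + 1) * τ))
      (Real.exp (ν * bmrLambda (m + 1) * r) * (ν * bmrLambda (m + 1))) r := by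
    have := ((hasDerivAt_id r).const_mul (ν * bmrLambda (m + 1))).exp
    simpa using this
  exact h1.hasDerivWithinAt.mul ((hX.2 (m + 1) (by omega) r hr).mono (Ici_subset_Ici.2 hr))

/-- **The first mode only decays**: `e^{νλ₁t}X₁(t) ≤ X₁(0)` for a non-negative weak solution
(`β ≠ 0`, `ν ≥ 0`). [cite: BarbatoMorandinRomito2011, §3.2 (proof of Thm. 1, second claim)] -/
theorem IsBMRWeakSolution.mode_one_le (hX : IsBMRWeakSolution ν β x X) (hβ : β ≠ 0) (hν : 0 ≤ ν)
    (hpos : ∀ n, 1 ≤ n → ∀ t, 0 ≤ t → 0 ≤ X n t) {t : ℝ} (ht : 0 ≤ t) :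
    Real.exp (ν * bmrLambda 1 * t) * X 1 t ≤ X 1 0 := by
  set V : ℝ → ℝ := fun τ => Real.exp (ν * bmrLambda 1 * τ) * X 1 τ with hV
  have hVc : ContinuousOn V (Icc 0 t) :=
    ((Real.continuous_exp.comp (continuous_const.mul continuous_id)).continuousOn.mul
      (hX.continuousOn le_rfl)).mono Icc_subset_Ici_self
  have hderiv : ∀ r ∈ Ico 0 t, HasDerivWithinAt V
      (Real.exp (ν * bmrLambda 1 * r) * (ν * bmrLambda 1) * X 1 r +
        Real.exp (ν * bmrLambda 1 * r) * bmrRHS ν β (fun k => X k r) 1) (Ici r) r :=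
    fun r hr => hX.hasDerivWithinAt_expWeight 0 hr.1
  have hbound : ∀ r ∈ Ico 0 t, Real.exp (ν * bmrLambda 1 * r) * (ν * bmrLambda 1) * X 1 r +
      Real.exp (ν * bmrLambda 1 * r) * bmrRHS ν β (fun k => X k r) 1 ≤ 0 + 0 * V r := by
    intro r hr
    have hL : bmrLambda 1 = 2 := by rw [bmrLambda_of_ne_zero one_ne_zero, pow_one]
    rw [bmrRHS_one hβ, hL]
    have he : 0 < Real.exp (ν * 2 * r) := Real.exp_pos _
    have hX1 := hpos 1 le_rfl r hr.1
    have hX2 := hpos 2 (by norm_num) r hr.1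
    have hLb : (0 : ℝ) ≤ (2 : ℝ) ^ β := by positivity
    have h1 : 0 ≤ Real.exp (ν * 2 * r) * (2 : ℝ) ^ β * (X 1 r * X 2 r) :=
      mul_nonneg (mul_nonneg he.le hLb) (mul_nonneg hX1 hX2)
    have h2 : 0 ≤ Real.exp (ν * 2 * r) * ν * X 1 r := mul_nonneg (mul_nonneg he.le hν) hX1
    nlinarith [h1, h2]
  have key := Literature.Analysis.ODE.le_linearComparison hVc hderiv continuousOn_const
    continuousOn_const hbound (right_mem_Icc.2 ht)
  simp only [Real.exp_zero, one_mul, zero_mul, intervalIntegral.integral_zero, add_zero] at key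
  simpa [hV] using key

/-- **One step of the bootstrap** (the estimate of Remark 3.4 / second claim, mode by mode, with
`ε = 1/100`): for a non-negative weak solution, `ν > 0`, `β > 2`, `t ≥ 0`, if the previous weighted
mode obeys `λ_{m+1}^{β-2+ε}e^{νλ_{m+1}r}X_{m+1}(r) ≤ M` on `[0, t]`, then
`λ_{m+2}^{β-2+ε}e^{νλ_{m+2}t}X_{m+2}(t) ≤ λ_{m+2}^{β-2+ε}X_{m+2}(0) + M²·C₀·t^{ε/2}`,
`C₀ = 2^{β-2+ε}(2ν)^{-(1-ε/2)}` — uniformly in `m`. Ingredients: linear comparison for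
`V = e^{νλₙ·}Xₙ` with rate `aₙ = ν(λₙ²-λₙ) ≥ νλₙ²/2`, the identity `e^{νλₙr}X_{n-1}² = V_{n-1}²`
(`λₙ = 2λ_{n-1}`), `(1-e^{-at})/a ≤ min{t, a⁻¹}` and the interpolation
`min{t,(2νL²)⁻¹} ≤ t^{ε/2}(2νL²)^{-(1-ε/2)}`. [cite: BarbatoMorandinRomito2011, §3.2 (proof of Thm. 1, second claim) and Rem. 3.4] -/
theorem IsBMRWeakSolution.mode_step (hX : IsBMRWeakSolution ν β x X) (hν : 0 < ν) (hβ2 : 2 < β)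
    (hpos : ∀ n, 1 ≤ n → ∀ t, 0 ≤ t → 0 ≤ X n t) (m : ℕ) {t M : ℝ} (ht : 0 ≤ t)
    (hprev : ∀ r ∈ Icc 0 t, bmrLambda (m + 1) ^ (β - 2 + 1 / 100) *
      Real.exp (ν * bmrLambda (m + 1) * r) * X (m + 1) r ≤ M) :
    bmrLambda (m + 2) ^ (β - 2 + 1 / 100) * Real.exp (ν * bmrLambda (m + 2) * t) * X (m + 2) t ≤
      bmrLambda (m + 2) ^ (β - 2 + 1 / 100) * X (m + 2) 0 +
        M ^ 2 * ((2 : ℝ) ^ (β - 2 + 1 / 100) * (2 * ν) ^ (-(199 : ℝ) / 200)) * t ^ ((1 : ℝ) / 200) := by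
  set s : ℝ := β - 2 + 1 / 100 with hs
  have hβ0 : β ≠ 0 := by linarith
  set L : ℝ := bmrLambda (m + 1) with hL
  have hL0 : 0 < L := bmrLambda_pos (Nat.succ_ne_zero m)
  have hL2 : bmrLambda (m + 2) = 2 * L := bmrLambda_succ_succ m
  have hLs : 0 < L ^ s := Real.rpow_pos_of_pos hL0 s
  -- the rate and the players
  set a : ℝ := ν * (bmrLambda (m + 2) ^ 2 - bmrLambda (m + 2)) with ha
  have ha2 : 2 * ν * L ^ 2 ≤ a := by
    rw [ha, hL2]
    have : 1 ≤ L := one_le_bmrLambda (Nat.succ_ne_zero m)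
    nlinarith [mul_nonneg (mul_nonneg hν.le hL0.le) (sub_nonneg.2 this)]
  have ha0 : 0 < a := lt_of_lt_of_le (by positivity) ha2
  set V : ℝ → ℝ := fun τ => Real.exp (ν * bmrLambda (m + 2) * τ) * X (m + 2) τ with hV
  set A : ℝ → ℝ := fun τ => L ^ β * (Real.exp (ν * bmrLambda (m + 2) * τ) * X (m + 1) τ ^ 2) with hA
  set Abar : ℝ := L ^ β * (M / L ^ s) ^ 2 with hAbar
  have hAbar0 : 0 ≤ Abar := by rw [hAbar]; exact mul_nonneg (Real.rpow_nonneg hL0.le β) (sq_nonneg _)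
  -- continuity
  have hexpc : Continuous fun τ : ℝ => Real.exp (ν * bmrLambda (m + 2) * τ) :=
    Real.continuous_exp.comp (continuous_const.mul continuous_id)
  have hVc : ContinuousOn V (Icc 0 t) :=
    (hexpc.continuousOn.mul (hX.continuousOn (by omega))).mono Icc_subset_Ici_self
  have hAc : ContinuousOn A (Icc 0 t) :=
    (continuousOn_const.mul (hexpc.continuousOn.mul ((hX.continuousOn (by omega)).pow 2))).mono
      Icc_subset_Ici_self
  -- the differential inequality `V' ≤ A + (-a) V`
  have hderiv : ∀ r ∈ Ico 0 t, HasDerivWithinAt V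
      (Real.exp (ν * bmrLambda (m + 2) * r) * (ν * bmrLambda (m + 2)) * X (m + 2) r +
        Real.exp (ν * bmrLambda (m + 2) * r) * bmrRHS ν β (fun k => X k r) (m + 2)) (Ici r) r :=
    fun r hr => hX.hasDerivWithinAt_expWeight (m + 1) hr.1
  have hbound : ∀ r ∈ Ico 0 t,
      Real.exp (ν * bmrLambda (m + 2) * r) * (ν * bmrLambda (m + 2)) * X (m + 2) r +
        Real.exp (ν * bmrLambda (m + 2) * r) * bmrRHS ν β (fun k => X k r) (m + 2) ≤
        A r + (-a) * V r := by
    intro r hr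
    rw [show m + 2 = (m + 1) + 1 from rfl, bmrRHS_succ]
    simp only [hA, hV, ha, ← hL]
    have he : 0 < Real.exp (ν * bmrLambda (m + 1 + 1) * r) := Real.exp_pos _
    have hX2 := hpos (m + 1 + 1) (by omega) r hr.1
    have hX3 := hpos (m + 1 + 2) (by omega) r hr.1
    have hLb : 0 ≤ bmrLambda (m + 1 + 1) ^ β := bmrLambda_rpow_nonneg _ β
    nlinarith [mul_nonneg (mul_nonneg he.le hLb) (mul_nonneg hX2 hX3)]
  have key := Literature.Analysis.ODE.le_linearComparison hVc hderiv hAc continuousOn_const hbound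
    (right_mem_Icc.2 ht)
  simp only [intervalIntegral.integral_const, smul_eq_mul, sub_zero] at key
  -- `key : V t ≤ exp (t * -a) * (V 0 + ∫ s in 0..t, A s * exp (-(s * -a)))`
  -- bound the source: `A ≤ Abar` on `[0, t]`
  have hA_le : ∀ r ∈ Icc 0 t, A r ≤ Abar := by
    intro r hr
    simp only [hA, hAbar]
    refine mul_le_mul_of_nonneg_left ?_ (Real.rpow_nonneg hL0.le β)
    have hsq : Real.exp (ν * bmrLambda (m + 2) * r) * X (m + 1) r ^ 2 =
        (Real.exp (ν * L * r) * X (m + 1) r) ^ 2 := by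
      rw [hL2, mul_pow, sq (Real.exp _), ← Real.exp_add]
      congr 1; congr 1; ring
    rw [hsq]
    have hW := hprev r hr
    have hVm : Real.exp (ν * L * r) * X (m + 1) r ≤ M / L ^ s := by
      rw [le_div_iff₀ hLs]
      calc Real.exp (ν * L * r) * X (m + 1) r * L ^ s
          = L ^ s * Real.exp (ν * L * r) * X (m + 1) r := by ring
        _ ≤ M := hW
    have hVm0 : 0 ≤ Real.exp (ν * L * r) * X (m + 1) r :=
      mul_nonneg (Real.exp_pos _).le (hpos (m + 1) (by omega) r hr.1)
    exact pow_le_pow_left₀ hVm0 hVm 2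
  have hint_le : ∫ r in (0 : ℝ)..t, A r * Real.exp (-(r * -a)) ≤ Abar * ((Real.exp (a * t) - 1) / a) := by
    have h1 : ∫ r in (0 : ℝ)..t, A r * Real.exp (-(r * -a)) ≤ ∫ r in (0 : ℝ)..t, Abar * Real.exp (a * r) := by
      refine intervalIntegral.integral_mono_on ht ?_ ?_ fun r hr => ?_
      · exact ((hAc.mul ((Real.continuous_exp.comp (by fun_prop)).continuousOn))).intervalIntegrable_of_Icc ht
      · exact (continuous_const.mul (Real.continuous_exp.comp (by fun_prop))).intervalIntegrable _ _
      · rw [show -(r * -a) = a * r by ring]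
        exact mul_le_mul_of_nonneg_right (hA_le r hr) (Real.exp_pos _).le
    rw [intervalIntegral.integral_const_mul, integral_exp_const_mul ha0.ne'] at h1
    exact h1
  -- assemble `V t ≤ V 0 + Abar min{t, 1/a}`
  have hV0 : 0 ≤ V 0 := mul_nonneg (Real.exp_pos _).le (hpos (m + 2) (by omega) 0 le_rfl)
  have hexp_le : Real.exp (t * -a) ≤ 1 := by
    rw [Real.exp_le_one_iff]; nlinarith
  have hVt : V t ≤ V 0 + Abar * min t (1 / a) := by
    have h1 : V t ≤ Real.exp (t * -a) * V 0 + Real.exp (t * -a) * (Abar * ((Real.exp (a * t) - 1) / a)) := by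
      have := key
      have h2 : Real.exp (t * -a) * (V 0 + ∫ r in (0 : ℝ)..t, A r * Real.exp (-(r * -a))) ≤
          Real.exp (t * -a) * (V 0 + Abar * ((Real.exp (a * t) - 1) / a)) :=
        mul_le_mul_of_nonneg_left (by linarith [hint_le]) (Real.exp_pos _).le
      linarith [h2]
    have h3 : Real.exp (t * -a) * (Abar * ((Real.exp (a * t) - 1) / a)) =
        Abar * ((1 - Real.exp (-(a * t))) / a) := by
      rw [show t * -a = -(a * t) by ring]
      have : Real.exp (-(a * t)) * Real.exp (a * t) = 1 := by rw [← Real.exp_add]; simp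
      field_simp
      linear_combination Abar * this
    rw [h3] at h1
    have h4 : Abar * ((1 - Real.exp (-(a * t))) / a) ≤ Abar * min t (1 / a) :=
      mul_le_mul_of_nonneg_left (one_sub_exp_neg_div_le ha0) hAbar0
    have h5 : Real.exp (t * -a) * V 0 ≤ V 0 := mul_le_of_le_one_left hV0 hexp_le
    linarith
  -- multiply by `λ_{m+2}^s = 2^s L^s` and make the gain scale-free
  have hLs2 : bmrLambda (m + 2) ^ s = (2 : ℝ) ^ s * L ^ s := by
    rw [hL2, Real.mul_rpow (by norm_num) hL0.le]
  have hmin : min t (1 / a) ≤ t ^ ((1 : ℝ) / 200) * (1 / (2 * ν * L ^ 2)) ^ ((199 : ℝ) / 200) := by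
    have h1 : min t (1 / a) ≤ min t (1 / (2 * ν * L ^ 2)) :=
      min_le_min le_rfl (one_div_le_one_div_of_le (by positivity) ha2)
    refine h1.trans ?_
    have := min_le_rpow_mul_rpow (a := t) (b := 1 / (2 * ν * L ^ 2)) (θ := (1 : ℝ) / 200) ht
      (by positivity) (by norm_num) (by norm_num)
    rwa [show (1 : ℝ) - 1 / 200 = 199 / 200 by norm_num] at this
  have hgain : (2 : ℝ) ^ s * L ^ s * Abar * (t ^ ((1 : ℝ) / 200) * (1 / (2 * ν * L ^ 2)) ^ ((199 : ℝ) / 200)) =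
      M ^ 2 * ((2 : ℝ) ^ s * (2 * ν) ^ (-(199 : ℝ) / 200)) * t ^ ((1 : ℝ) / 200) := by
    simp only [hAbar]
    -- `L^s · L^β/(L^s)² · (L²)^{-199/200} = 1` since `β - s = 199/100`
    have hLβ : L ^ β = L ^ s * L ^ ((199 : ℝ) / 100) := by
      rw [← Real.rpow_add hL0]; congr 1; rw [hs]; ring
    have hinv : (1 / (2 * ν * L ^ 2)) ^ ((199 : ℝ) / 200) =
        (2 * ν) ^ (-(199 : ℝ) / 200) * (L ^ ((199 : ℝ) / 100))⁻¹ := by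
      rw [one_div, Real.inv_rpow (by positivity), Real.mul_rpow (by positivity) (by positivity)]
      rw [show (L ^ 2 : ℝ) = L ^ (2 : ℝ) by norm_cast, ← Real.rpow_mul hL0.le]
      rw [neg_div, Real.rpow_neg (by positivity)]
      rw [mul_inv]
      norm_num
    have hL199 : 0 < L ^ ((199 : ℝ) / 100) := Real.rpow_pos_of_pos hL0 _
    rw [hLβ, hinv]
    field_simp
  calc bmrLambda (m + 2) ^ s * Real.exp (ν * bmrLambda (m + 2) * t) * X (m + 2) t
      = bmrLambda (m + 2) ^ s * V t := by simp only [hV]; ring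
    _ ≤ bmrLambda (m + 2) ^ s * (V 0 + Abar * min t (1 / a)) :=
        mul_le_mul_of_nonneg_left hVt (Real.rpow_nonneg (bmrLambda_nonneg _) s)
    _ = bmrLambda (m + 2) ^ s * X (m + 2) 0 + (2 : ℝ) ^ s * L ^ s * Abar * min t (1 / a) := by
        simp only [hV, mul_zero, Real.exp_zero, one_mul]; rw [hLs2]; ring
    _ ≤ bmrLambda (m + 2) ^ s * X (m + 2) 0 +
        (2 : ℝ) ^ s * L ^ s * Abar * (t ^ ((1 : ℝ) / 200) * (1 / (2 * ν * L ^ 2)) ^ ((199 : ℝ) / 200)) := by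
        gcongr
    _ = _ := by rw [hgain]

end Modes

/-! ## The second claim: the bootstrap -/

section Bootstrap

variable {ν β : ℝ} {x : ℕ → ℝ} {X : ℕ → ℝ → ℝ}

/-- **Barbato–Morandin–Romito 2011, proof of Thm. 1, second claim, quantitative form**
(`ε = 1/100`). Let `ν > 0`, `β > 2`, `X` a weak solution of (1.1) with non-negative datum
satisfying `λₙ^{β-2+ε}xₙ ≤ K` for all `n ≥ 1` (`K > 0`), and let `T ≥ 0` be so short that
`4K·C₀·T^{ε/2} ≤ 1/2`, `C₀ = 2^{β-2+ε}(2ν)^{-(1-ε/2)}`. Then for all `t ∈ [0, T]` and `n ≥ 1`: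
`λₙ^{β-2+ε} e^{νλₙt} Xₙ(t) ≤ 2K` — the solution enters, and stays for a while in, the smooth class
with exponential weights (`V` bounded in `W_ε`, in the notation of the source). Proof: for each
`N`, a continuity argument (`maximalTimeP`) on `P(t) : ∀ n ≤ N, Wₙ(t) ≤ 2K` using `mode_one_le` and
`mode_step` (which give the *strict* bound `Wₙ ≤ K + 4K²C₀T^{ε/2} ≤ 3K/2` at the maximal time).
[cite: BarbatoMorandinRomito2011, §3.2 (proof of Thm. 1, second claim)] -/
theorem IsBMRWeakSolution.scale_exp_bound (hX : IsBMRWeakSolution ν β x X) (hν : 0 < ν)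
    (hβ2 : 2 < β) (hx : ∀ n, 1 ≤ n → 0 ≤ x n) {K T : ℝ} (hK : 0 < K) (hT : 0 ≤ T)
    (hbd : ∀ n, 1 ≤ n → bmrLambda n ^ (β - 2 + 1 / 100) * x n ≤ K)
    (hsmall : 4 * K * ((2 : ℝ) ^ (β - 2 + 1 / 100) * (2 * ν) ^ (-(199 : ℝ) / 200)) *
      T ^ ((1 : ℝ) / 200) ≤ 1 / 2) :
    ∀ t ∈ Icc 0 T, ∀ n, 1 ≤ n →
      bmrLambda n ^ (β - 2 + 1 / 100) * Real.exp (ν * bmrLambda n * t) * X n t ≤ 2 * K := by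
  set s : ℝ := β - 2 + 1 / 100 with hs
  set C₀ : ℝ := (2 : ℝ) ^ (β - 2 + 1 / 100) * (2 * ν) ^ (-(199 : ℝ) / 200) with hC₀
  have hβ0 : β ≠ 0 := by linarith
  have hpos := hX.nonneg hβ0 hx
  have hC₀0 : 0 ≤ C₀ := by rw [hC₀]; positivity
  -- the weighted modes and their continuity
  set W : ℕ → ℝ → ℝ := fun n t => bmrLambda n ^ s * Real.exp (ν * bmrLambda n * t) * X n t with hW
  have hWc : ∀ n, 1 ≤ n → ContinuousOn (W n) (Ici 0) := fun n hn =>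
    (continuousOn_const.mul (Real.continuous_exp.comp (continuous_const.mul continuous_id)).continuousOn).mul
      (hX.continuousOn hn)
  have hW0 : ∀ n, 1 ≤ n → W n 0 ≤ K := by
    intro n hn
    simp only [hW, mul_zero, Real.exp_zero, mul_one, hX.1 n hn]
    exact hbd n hn
  -- the strict bound at any time up to which `P` holds
  have hstrict : ∀ t ∈ Icc 0 T, ∀ n, 1 ≤ n →
      (∀ r ∈ Icc 0 t, ∀ k, 1 ≤ k → k + 1 ≤ n → W k r ≤ 2 * K) → W n t < 2 * K := by
    intro t ht n hn hprev
    rcases Nat.lt_or_ge n 2 with hn1 | hn2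
    · -- the first mode
      have hn1' : n = 1 := by omega
      subst hn1'
      have h := hX.mode_one_le hβ0 hν.le hpos ht.1
      have hL : 0 ≤ bmrLambda 1 ^ s := Real.rpow_nonneg (bmrLambda_nonneg 1) s
      calc W 1 t = bmrLambda 1 ^ s * (Real.exp (ν * bmrLambda 1 * t) * X 1 t) := by
            simp only [hW]; ring
        _ ≤ bmrLambda 1 ^ s * X 1 0 := mul_le_mul_of_nonneg_left h hL
        _ ≤ K := by rw [hX.1 1 le_rfl]; exact hbd 1 le_rfl
        _ < 2 * K := by linarith
    · obtain ⟨m, rfl⟩ : ∃ m, n = m + 2 := ⟨n - 2, by omega⟩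
      have hstep := hX.mode_step hν hβ2 hpos m ht.1 (M := 2 * K)
        (fun r hr => hprev r hr (m + 1) (by omega) (by omega))
      have hinit : bmrLambda (m + 2) ^ s * X (m + 2) 0 ≤ K := by
        rw [hX.1 (m + 2) (by omega)]; exact hbd (m + 2) (by omega)
      have htT : t ^ ((1 : ℝ) / 200) ≤ T ^ ((1 : ℝ) / 200) :=
        Real.rpow_le_rpow ht.1 ht.2 (by norm_num)
      have hgain : (2 * K) ^ 2 * C₀ * t ^ ((1 : ℝ) / 200) ≤ K / 2 := by
        calc (2 * K) ^ 2 * C₀ * t ^ ((1 : ℝ) / 200) ≤ (2 * K) ^ 2 * C₀ * T ^ ((1 : ℝ) / 200) :=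
              mul_le_mul_of_nonneg_left htT (by positivity)
          _ = K * (4 * K * C₀ * T ^ ((1 : ℝ) / 200)) := by ring
          _ ≤ K * (1 / 2) := mul_le_mul_of_nonneg_left hsmall hK.le
          _ = K / 2 := by ring
      calc W (m + 2) t ≤ bmrLambda (m + 2) ^ s * X (m + 2) 0 + (2 * K) ^ 2 * C₀ * t ^ ((1 : ℝ) / 200) := hstep
        _ ≤ K + K / 2 := add_le_add hinit hgain
        _ < 2 * K := by linarith
  -- the continuity argument, for each finite family of modes
  intro t ht n hn
  set N := n with hN
  set P : ℝ → Prop := fun τ => ∀ k, 1 ≤ k → k ≤ N → W k τ ≤ 2 * K with hP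
  have hP0 : P 0 := fun k hk _ => (hW0 k hk).trans (by linarith)
  have hclosed : ∀ τ ∈ Ioc 0 T, (∀ r ∈ Ico 0 τ, P r) → P τ := by
    intro τ hτ hPr k hk hkN
    exact Literature.Analysis.ODE.le_const_of_forall_Ico ((hWc k hk).mono Icc_subset_Ici_self)
      ⟨hτ.1, le_rfl⟩ fun r hr => hPr r hr k hk hkN
  set τ := Literature.Analysis.ODE.maximalTimeP P 0 T with hτ
  have hτmem : τ ∈ Icc 0 T := Literature.Analysis.ODE.maximalTimeP_mem hT hP0
  have hspec : ∀ r ∈ Icc 0 τ, P r := fun r hr =>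
    Literature.Analysis.ODE.maximalTimeP_spec hT hP0 hclosed hr
  suffices hPT : ∀ r ∈ Icc 0 T, P r from hPT t ht n hn le_rfl
  rcases eq_or_lt_of_le hτmem.2 with hτT | hτT
  · intro r hr; exact hspec r ⟨hr.1, hτT ▸ hr.2⟩
  exfalso
  refine Literature.Analysis.ODE.not_eventually_of_maximalTimeP_lt hT hP0 hτT ?_
  -- at `τ` every mode `≤ N` is strictly below `2K`, hence so shortly after
  have hlt : ∀ k ∈ Finset.Icc 1 N, ∀ᶠ r in 𝓝[>] τ, W k r < 2 * K := by
    intro k hk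
    rw [Finset.mem_Icc] at hk
    have hWk : W k τ < 2 * K := hstrict τ hτmem k hk.1 fun r hr j hj hjk =>
      hspec r hr j hj (by omega)
    have hcw : ContinuousWithinAt (W k) (Ioi τ) τ :=
      ((hWc k hk.1) τ hτmem.1).mono fun r hr => hτmem.1.trans (le_of_lt hr)
    exact Filter.Tendsto.eventually_lt hcw tendsto_const_nhds hWk
  have evP : ∀ᶠ r in 𝓝[>] τ, P r := by
    have := (Finset.eventually_all (Finset.Icc 1 N)).2 hlt
    exact this.mono fun r hr k hk hkN => (hr k (Finset.mem_Icc.2 ⟨hk, hkN⟩)).le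
  rw [eventually_nhdsWithin_iff] at evP ⊢
  filter_upwards [evP] with r hr hrI
  rcases le_or_gt r τ with hle | hgt
  · exact hspec r ⟨hrI.1, hle⟩
  · exact hr hgt

end Bootstrap

end Literature.Barriers.NavierStokesRegularity.Dyadic
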